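import Mathlib.Probability.Distributions.Gaussian.Multivariate
import HarnessLib

/-!
# Crux `BirComplexStableXYR` (stmt-HubbardSuperconductivity-14845), line `fat-gaussian-defect-calculus`:
# stub `stub_multivariateGaussian_functional` — law of a linear functional under a centred Gaussian

Helper (`--supports`) for the crux
`Summit.HubbardSuperconductivity.HubbardSuperconductivity.Theses.BalabanIR.BirComplexStableXYR`, line
`fat-gaussian-defect-calculus` (lead skeleton `Cruxes/BirComplexStableXYR/Lines/fat_gaussian_defect_calculus.lean`),
registered stub `stub_multivariateGaussian_functional`.

**Statement.** For a finite index type `ι`, a positive semidefinite real matrix `S : Matrix ι ι ℝ` and a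
coefficient vector `a : ι → ℝ`, the image of the centred multivariate Gaussian `N(0, S)` on
`EuclideanSpace ℝ ι` (Mathlib `ProbabilityTheory.multivariateGaussian 0 S`) under the linear functional
`x ↦ a ⬝ᵥ ofLp x = ∑ i, a i * x i` is the real Gaussian `gaussianReal 0 (aᵀ S a).toNNReal`
(generic large-field input: one-dimensional marginals of lattice Gaussians).

**Proof.** The functional is the continuous linear form `L = innerSL ℝ (toLp 2 a)` (on `EuclideanSpace`
the inner product is the dot product, `EuclideanSpace.inner_toLp_toLp`).  `multivariateGaussian 0 S` is a
Gaussian measure (`ProbabilityTheory.isGaussian_multivariateGaussian`), so by the defining property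
`IsGaussian.map_eq_gaussianReal` its image under `L` is `gaussianReal (μ[L]) (Var[L; μ]).toNNReal`.
The mean is `μ[L] = L (∫ x, x ∂μ) = L 0 = 0` (`ContinuousLinearMap.integral_comp_id_comm`,
`integral_id_multivariateGaussian`), and the variance is
`Var[⟪toLp 2 a, ·⟫; μ] = covarianceBilin μ (toLp 2 a) (toLp 2 a) = a ⬝ᵥ S *ᵥ a`
(`covarianceBilin_self`, `covarianceBilin_multivariateGaussian`).
No definitions; sorry-free; everything is Mathlib. [folklore]
-/

set_option linter.dupNamespace false -- `Summit.<S>.<S>.Theorems…` repeats the summit name (D-0017 layout)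

noncomputable section

namespace Summit.HubbardSuperconductivity.HubbardSuperconductivity.Theorems.FSUnfolding

open scoped BigOperators Matrix RealInnerProductSpace
open MeasureTheory ProbabilityTheory WithLp

/-- The dot-product functional `x ↦ a ⬝ᵥ ofLp x` on `EuclideanSpace ℝ ι` is the continuous linear form
`innerSL ℝ (toLp 2 a)` (Riesz vector `toLp 2 a`). [folklore] -/
theorem hsc_dotProduct_ofLp_eq_innerSL {ι : Type*} [Fintype ι] (a : ι → ℝ) :
    (fun x : EuclideanSpace ℝ ι => a ⬝ᵥ ofLp x) =
      ⇑(innerSL ℝ (toLp 2 a) : EuclideanSpace ℝ ι →L[ℝ] ℝ) := by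
  funext x
  rw [innerSL_apply_apply, EuclideanSpace.inner_eq_star_dotProduct, star_trivial, ofLp_toLp,
    dotProduct_comm]

/-- Mean of a continuous linear form under the centred multivariate Gaussian: `∫ L dN(0, S) = 0`.
[folklore] -/
theorem hsc_integral_clm_multivariateGaussian_zero {ι : Type*} [Fintype ι] [DecidableEq ι]
    (S : Matrix ι ι ℝ) (L : EuclideanSpace ℝ ι →L[ℝ] ℝ) :
    (multivariateGaussian 0 S)[L] = 0 := by
  rw [L.integral_comp_id_comm IsGaussian.integrable_id, integral_id_multivariateGaussian, map_zero]

/-- Variance of the Riesz functional `⟪toLp 2 a, ·⟫` under the centred multivariate Gaussian `N(0, S)`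
with `S` positive semidefinite: `Var = aᵀ S a` (`covarianceBilin_multivariateGaussian`). [folklore] -/
theorem hsc_variance_innerSL_multivariateGaussian {ι : Type*} [Fintype ι] [DecidableEq ι]
    {S : Matrix ι ι ℝ} (hS : S.PosSemidef) (a : ι → ℝ) :
    Var[(innerSL ℝ (toLp 2 a) : EuclideanSpace ℝ ι →L[ℝ] ℝ); multivariateGaussian 0 S] =
      a ⬝ᵥ S *ᵥ a := by
  have h := covarianceBilin_self (μ := multivariateGaussian 0 S) IsGaussian.memLp_two_id (toLp 2 a)
  rw [covarianceBilin_multivariateGaussian hS, ofLp_toLp] at h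
  rw [h]
  rfl

/-- Registered stub `stub_multivariateGaussian_functional`: under the centred multivariate Gaussian
`N(0, S)` on `EuclideanSpace ℝ ι` (`S` positive semidefinite), the law of the linear functional
`x ↦ a ⬝ᵥ ofLp x` is the real Gaussian `gaussianReal 0 (a ⬝ᵥ S *ᵥ a).toNNReal`. [folklore] -/
theorem stub_multivariateGaussian_functional :
    ∀ (ι : Type) [Fintype ι] [DecidableEq ι] (S : Matrix ι ι ℝ), S.PosSemidef → ∀ (a : ι → ℝ),
      (ProbabilityTheory.multivariateGaussian 0 S).map (fun x => a ⬝ᵥ WithLp.ofLp x) =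
        ProbabilityTheory.gaussianReal 0 (a ⬝ᵥ S *ᵥ a).toNNReal := by
  intro ι _ _ S hS a
  rw [hsc_dotProduct_ofLp_eq_innerSL a, IsGaussian.map_eq_gaussianReal,
    hsc_integral_clm_multivariateGaussian_zero S, hsc_variance_innerSL_multivariateGaussian hS a]

end Summit.HubbardSuperconductivity.HubbardSuperconductivity.Theorems.FSUnfolding

end
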